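import Summits.FinalStateConjecture.FinalStateConjecture.Theorems.ChannelsResolveTameDevelopmentsR.Negative.SlabMinkowskiCharts
import Literature.Geometry.Lorentzian.TrivialDataAdmissible
import HarnessLib

/-!
# `IsMaximal` and complete `𝓘⁺` are jointly load-bearing in K2R ≡ Φ: the time slab of Minkowski space is an
# admissible, tame, non-settling vacuum Cauchy development — negative-side support for the crux
# `ChannelsResolveTameDevelopmentsR` (K2R, item `stmt-FinalStateConjecture-14075`, route PhotonSphereChannels)

The crux K2R is `K1R → Φ` with `K1R` a theorem (`Theorems.uniformPhotonSphereChannelsR_proof`), so K2R is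
equivalent to tame final-state resolution Φ: every MAXIMAL vacuum Cauchy development of admissible data with
COMPLETE future null infinity satisfying (i) no extremal-Kerr late chart and (ii) tameness of the outer region
admits an honest exhaustive `2`-decomposition. This file records, kernel-checked, what the route's disprover
argued on paper (crux dossier `Cruxes/ChannelsResolveTameDevelopmentsR/Disproof.lean`, §4, docstring of
`TameResolutionAllDevelopments`): **the two structural hypotheses `IsMaximal` and complete `𝓘⁺` cannot both
be dropped** — the statement Φ with both deleted (everything else verbatim) is FALSE
(`not_tameResolution_allDevelopments`), the witness being the time slab `{-1 < x⁰ < 1}` of Minkowski space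
over the trivial admissible datum `(ℝ³, δ, 0)` (`slab`, files `SlabMinkowski`, `SlabMinkowskiCharts`):
admissible (`trivialData_mem_admissibleVacuumData`), (i) holds (`slab_noExtremalChart`), (ii) holds
(`slab_tame`: no null ray from the data is future complete, so the outer region is empty), and yet no region
of it carries a final-state decomposition in any `Cᵏ` (`isEmpty_finalStateDecomposition_slab`: a late Kerr
or flat chart would contain a uniformly timelike coordinate line of unbounded chart time, impossible inside
`{-1 < x⁰ < 1}`). The slab fails BOTH deleted hypotheses (it embeds properly into Minkowski space,
`slab_embedsInto`; its null rays have affine domain `⊆ (-∞, 1)`, `slab_ray_dom_subset_Iio`), which is why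
neither single deletion is refuted by it; Φ itself (and K2R) is untouched — it is the open core of the summit
on the tame locus.

Consequence for re-lining K2R (planner-facing): any line must USE maximality or completeness of `𝓘⁺` of the
development essentially (e.g. through exterior stability near `i⁰` / existence of a radiation zone); a line
whose stubs only consume (i), (ii) and the vacuum equations is refuted by `slab`.

All results proved; no named facts; axioms `propext`, `Classical.choice`, `Quot.sound`.
-/

noncomputable section

open Bundle Set Function Filter TopologicalSpace Topology
open scoped Manifold ContDiff Topology ENNReal

set_option linter.dupNamespace false

namespace Summit.FinalStateConjecture.FinalStateConjecture.Theorems.ChannelsResolveTameDevelopmentsR.Negative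

open Literature.Geometry.Lorentzian Literature.Geometry.Lorentzian.Minkowski

/-- **The admissible tame non-settling witness.** The trivial datum `(ℝ³, δ, 0)` on the Minkowski slice is
admissible, and its vacuum Cauchy development `slab` (the time slab `{-1 < x⁰ < 1}`) satisfies hypotheses
(i) (no extremal late chart) and (ii) (tame outer region) of K2R/Φ but not its conclusion (no honest
exhaustive `2`-decomposition of any region). -/
theorem slab_witness :
    trivialData ∈ admissibleVacuumData Minkowski.slice ∧
      (∀ (Λ : lorentzGroup) (c : E4) (M a : ℝ), Kerr.IsExtremal M a →
        ¬ ∃ (τ₀ : ℝ) (Ψ : (boostedKerrBackground Λ c M a).domain → slab.carrier),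
          slab.toSpacetime.IsLateChart (boostedKerrBackground Λ c M a) Set.univ τ₀ Ψ ∧
            ∀ R : ℝ, Tendsto
              (fun τ ↦ slab.toSpacetime.truncDeviationCk (boostedKerrBackground Λ c M a) Ψ 2 R τ)
              atTop (𝓝 0)) ∧
      (¬ ∃ (O : Set slab.carrier) (d : FinalStateDecomposition slab.toSpacetime O 2),
        O = _root_.Summit.FinalStateConjecture.exteriorOf slab.toCauchyDevelopment d.charted ∧
          _root_.Summit.FinalStateConjecture.HasExhaustiveCharts d) :=
  ⟨trivialData_mem_admissibleVacuumData, slab_noExtremalChart, slab_not_settles⟩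

/-- **Φ with `IsMaximal` and complete `𝓘⁺` both deleted is false** (the statement is the body of
`Disproof.TameResolutionAllDevelopments` of the crux dossier, verbatim: Φ = tame resolution asserted for
EVERY vacuum Cauchy development of admissible data, complete or not, maximal or not). Witness: `slab`
(`slab_witness`, `slab_tame`). Hence the pair {`IsMaximal`, complete `𝓘⁺`} is load-bearing in K2R ≡ Φ. -/
theorem not_tameResolution_allDevelopments :
    ¬ ∀ (X : Type) [TopologicalSpace X] [ChartedSpace Literature.Geometry.Lorentzian.E3 X] [IsManifold (modelWithCornersSelf ℝ Literature.Geometry.Lorentzian.E3) ((⊤ : ℕ∞) : WithTop ℕ∞) X] [T2Space X] [SecondCountableTopology X] [ConnectedSpace X], ∀ D ∈ Literature.Geometry.Lorentzian.admissibleVacuumData X, ∀ 𝒟 : Literature.Geometry.Lorentzian.VacuumCauchyDevelopment D, ((∀ (Λ : Literature.Geometry.Lorentzian.lorentzGroup) (c : Literature.Geometry.Lorentzian.E4) (M a : ℝ), Literature.Geometry.Lorentzian.Kerr.IsExtremal M a → ¬ ∃ (τ₀ : ℝ) (Ψ : (Literature.Geometry.Lorentzian.boostedKerrBackground Λ c M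 a).domain → 𝒟.carrier), 𝒟.toSpacetime.IsLateChart (Literature.Geometry.Lorentzian.boostedKerrBackground Λ c M a) Set.univ τ₀ Ψ ∧ ∀ R : ℝ, Filter.Tendsto (fun τ => 𝒟.toSpacetime.truncDeviationCk (Literature.Geometry.Lorentzian.boostedKerrBackground Λ c M a) Ψ 2 R τ) Filter.atTop (nhds 0)) ∧ ∀ [𝒟.metric.HasLeviCivita], let outer : Set 𝒟.carrier := 𝒟.metric.causalFuture 𝒟.timeOrientation (Set.range 𝒟.embed) ∩ {q | ∃ (p : X) (γ : ℝ → 𝒟.carrier) (dom : Set ℝ), 𝒟.metric.IsNormalisedNullRayFrom 𝒟.timeOrientation 𝒟.embed 𝒟.normal p γ dom ∧ ¬ BddAbove dom ∧ q ∈ 𝒟.metric.chronologicalPast 𝒟.timeOrientation (γ '' (dom ∩ Set.Ici 0))}; ∃ r₀ : ℝ, 0 < r₀ ∧ ∃ Λ : NNReal, ∀ q ∈ outer, let U : TopologicalSpace.Opens Literature.Geometry.Lorentzian.E4 := ⟨Metric.ball (0 : Literature.Geometry.Lorentzian.E4) r₀, Metric.isOpen_ball⟩; ∃ Ψ : U →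 𝒟.carrier, 𝒟.toSpacetime.IsLateChart (Literature.Geometry.Lorentzian.Minkowski.backgroundOn U) Set.univ (-r₀) Ψ ∧ (∃ x : U, (x : Literature.Geometry.Lorentzian.E4) = 0 ∧ Ψ x = q) ∧ Literature.Geometry.Lorentzian.supCkENorm (U : Set Literature.Geometry.Lorentzian.E4) 3 (𝒟.toSpacetime.deviationExtend (Literature.Geometry.Lorentzian.Minkowski.backgroundOn U) Ψ) ≤ (Λ : ENNReal) ∧ Literature.Geometry.Lorentzian.supCkENorm (U : Set Literature.Geometry.Lorentzian.E4) 0 (𝒟.toSpacetime.deviationExtend (Literature.Geometry.Lorentzian.Minkowski.backgroundOn U) Ψ) ≤ 1 / 2) → ∃ (O : Set 𝒟.carrier) (d : Literature.Geometry.Lorentzian.FinalStateDecomposition 𝒟.toSpacetime O 2), O = _root_.Summit.FinalStateConjecture.exteriorOf 𝒟.toCauchyDevelopment d.charted ∧ _root_.Summit.FinalStateConjecture.HasExhaustiveCharts d := by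
  intro h
  exact slab_not_settles (h (↥Minkowski.slice) trivialData trivialData_mem_admissibleVacuumData slab
    ⟨slab_noExtremalChart, slab_tame⟩)

end Summit.FinalStateConjecture.FinalStateConjecture.Theorems.ChannelsResolveTameDevelopmentsR.Negative

end
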